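import Summits.KontsevichZagierPeriods.KontsevichZagierPeriods.Theorems.RootDecompRelativeModAbsoluteCylLogSplitP02

/-! # `RootDecompRelativeModAbsoluteCylLogSplitP03` — part 3/25 of the mechanical ≤330-line split of `CylLogSplit.lean`
(split by the decomp-kz census seat for landing; mathematics unchanged; part 3 continues part 2). -/

noncomputable section
open Set MeasureTheory Filter Topology
open scoped BigOperators
open Literature.NumberTheory.Transcendental Literature.ModelTheory.ExponentialFields

namespace Summit.KontsevichZagierPeriods.RootDecompRelativeModAbsolute.Rung30571

namespace RegularisedLogLayer

namespace CylLog
variable {b : ℕ}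

/-- **`RegTorusProductPos` (core form), PROVED.** See the section docstring. -/
theorem regTorusProductPos_core {b m : ℕ} {G : Set (Fin b → ℝ)} {d u w : (Fin b → ℝ) → ℝ}
    (hGo : IsOpen G) (hG : IsSemialgebraic ℚ G) (hd : IsSemialgebraicFunOn ℚ G d)
    (hu : IsSemialgebraicFunOn ℚ G u) (hw : IsSemialgebraicFunOn ℚ G w)
    (hud : DifferentiableOn ℝ u G) (hu1 : ∀ x ∈ G, 1 ≤ u x) (hw1 : ∀ x ∈ G, 1 ≤ w x)
    (R R₁ R₂ S : KZ.IntegralRep (b + 1)) (B : KZ.IntegralRep b)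
    (hRd : R.domain = KZlog.band G (fun _ => 1) (fun x => u x * w x))
    (hRi : EqOn R.integrand
      (fun z => d (Fin.init z) * ((z (Fin.last b) - 1) ^ m / z (Fin.last b))) R.domain)
    (hR₁d : R₁.domain = KZlog.band G (fun _ => 1) u)
    (hR₁i : EqOn R₁.integrand
      (fun z => d (Fin.init z) * ((z (Fin.last b) - 1) ^ m / z (Fin.last b))) R₁.domain)
    (hR₂d : R₂.domain = KZlog.band G (fun _ => 1) w)
    (hR₂i : EqOn R₂.integrand
      (fun z => d (Fin.init z) * ((z (Fin.last b) - 1) ^ m / z (Fin.last b))) R₂.domain)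
    (hSd : S.domain = KZlog.band G (fun _ => 1) w)
    (hSi : EqOn S.integrand
      (fun z => d (Fin.init z) * ((u (Fin.init z) * z (Fin.last b) - 1) ^ m / z (Fin.last b)))
      S.domain)
    (hBd : B.domain = G) (hBi : EqOn B.integrand (fun x => d x * rho m (u x) (w x)) B.domain) :
    KZ.of R - KZ.of R₁ - KZ.of R₂ - KZ.of B ∈ KZ.relations := by
  have huw : IsSemialgebraicFunOn ℚ G (fun x => u x * w x) := IsSemialgebraicFunOn.mul_holds hu hw
  have hc1 : IsSemialgebraicFunOn ℚ G (fun _ => (1 : ℝ)) := by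
    simpa using isSemialgebraicFunOn_ratCast hG 1
  have hle : ∀ x ∈ G, u x ≤ u x * w x := fun x hx =>
    le_mul_of_one_le_right (zero_le_one.trans (hu1 x hx)) (hw1 x hx)
  -- 1. split `R` at `t = u x` (rule 1a; the graph of `u` is null)
  have hbl : IsSemialgebraic ℚ (KZlog.band G (fun _ => 1) u) := KZlog.isSemialgebraic_band hc1 hu
  have hbu : IsSemialgebraic ℚ (KZlog.band G u fun x => u x * w x) :=
    KZlog.isSemialgebraic_band hu huw
  have hbw : IsSemialgebraic ℚ (KZlog.band G (fun _ => 1) w) := KZlog.isSemialgebraic_band hc1 hw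
  have hsubl : KZlog.band G (fun _ => 1) u ⊆ R.domain := fun z hz =>
    hRd ▸ ⟨hz.1, hz.2.1, hz.2.2.trans (hle _ hz.1)⟩
  have hsubu : KZlog.band G u (fun x => u x * w x) ⊆ R.domain := fun z hz =>
    hRd ▸ ⟨hz.1, (hu1 _ hz.1).trans hz.2.1, hz.2.2⟩
  set Rl := R.restrict _ hbl hsubl with hRl
  set Ru := R.restrict _ hbu hsubu with hRu
  have hsplit : KZ.of R - KZ.of Rl - KZ.of Ru ∈ KZ.relations := by
    refine KZ.domainAddRel_subset_relations ⟨b + 1, R, Rl, Ru, ?_, ?_, fun _ _ => rfl,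
      fun _ _ => rfl, rfl⟩
    · rw [hRd, hRl, hRu, KZ.IntegralRep.domain_restrict, KZ.IntegralRep.domain_restrict]
      ext z
      simp only [KZlog.band, mem_setOf_eq, mem_union]
      constructor
      · rintro ⟨hx, h1, h2⟩
        rcases le_total (z (Fin.last b)) (u (Fin.init z)) with h | h
        · exact Or.inl ⟨hx, h1, h⟩
        · exact Or.inr ⟨hx, h, h2⟩
      · rintro (⟨hx, h1, h2⟩ | ⟨hx, h1, h2⟩)
        · exact ⟨hx, h1, h2.trans (hle _ hx)⟩
        · exact ⟨hx, (hu1 _ hx).trans h1, h2⟩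
    · refine measure_mono_null (fun z hz => ?_) (KZ.volume_graph_eq_zero hu)
      rw [hRl, hRu, KZ.IntegralRep.domain_restrict, KZ.IntegralRep.domain_restrict] at hz
      exact ⟨hz.1.1, le_antisymm hz.1.2.2 hz.2.2.1⟩
  have hl : KZ.of Rl - KZ.of R₁ ∈ KZ.relations :=
    KZ.of_sub_of_mem_relations_of_eqOn (by rw [hR₁d, hRl, KZ.IntegralRep.domain_restrict])
      fun z hz => by
        rw [hRl, KZ.IntegralRep.integrand_restrict, hRi (hsubl hz), hR₁i (hR₁d ▸ hz)]
  -- 2. the substitution `t = u(x) s` carries `S` to `Ru` (rule 2)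
  have hmain : KZ.of S - KZ.of Ru ∈ KZ.relations := by
    refine KZ.of_sub_of_mem_relations_of_affine hGo (α := fun _ => 0) (β := u)
      (by simpa using isSemialgebraicFunOn_ratCast hG 0) hu (differentiableOn_const _) hud
      (fun y hy => one_pos.trans_le (hu1 y hy)) S Ru hSd
      (by rw [hRu, KZ.IntegralRep.domain_restrict]) (fun y _ => by ring) (fun y _ => by ring)
      fun z hz => ?_
    have hz' : z ∈ KZlog.band G (fun _ => 1) w := hSd ▸ hz
    obtain ⟨hx, hs1, hsw⟩ := hz'
    have hux : 1 ≤ u (Fin.init z) := hu1 _ hx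
    have hu0 : u (Fin.init z) ≠ 0 := (one_pos.trans_le hux).ne'
    have hs0 : z (Fin.last b) ≠ 0 := (one_pos.trans_le hs1).ne'
    have hmem : (Fin.snoc (Fin.init z) (0 + u (Fin.init z) * z (Fin.last b)) : Fin (b + 1) → ℝ) ∈
        KZlog.band G u (fun x => u x * w x) := by
      rw [KZlog.snoc_mem_band]
      refine ⟨hx, ?_, ?_⟩
      · simpa using le_mul_of_one_le_right (zero_le_one.trans hux) hs1
      · simpa using mul_le_mul_of_nonneg_left hsw (zero_le_one.trans hux)
    rw [hSi hz, hRu, KZ.IntegralRep.integrand_restrict, hRi (hsubu hmem)]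
    simp only [Fin.init_snoc, Fin.snoc_last, zero_add]
    field_simp
  -- 3. the polynomial band `P = S − R₂` on `{1 ≤ s ≤ w}` (rule 1b)
  have hSsa : IsSemialgebraicFunOn ℚ (KZlog.band G (fun _ => 1) w) S.integrand := by
    rw [← hSd]; exact S.isSemialgebraicFunOn_integrand
  have hR₂sa : IsSemialgebraicFunOn ℚ (KZlog.band G (fun _ => 1) w) R₂.integrand := by
    rw [← hR₂d]; exact R₂.isSemialgebraicFunOn_integrand
  have hSint : IntegrableOn S.integrand (KZlog.band G (fun _ => 1) w) := by
    rw [← hSd]; exact S.integrableOn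
  have hR₂int : IntegrableOn R₂.integrand (KZlog.band G (fun _ => 1) w) := by
    rw [← hR₂d]; exact R₂.integrableOn
  let P : KZ.IntegralRep (b + 1) :=
    { domain := KZlog.band G (fun _ => 1) w
      integrand := fun z => S.integrand z - R₂.integrand z
      isSemialgebraic_domain := hbw
      isSemialgebraicFunOn_integrand := IsSemialgebraicFunOn.sub_holds hSsa hR₂sa
      integrableOn := hSint.sub hR₂int }
  have hPrel : KZ.of S - KZ.of R₂ - KZ.of P ∈ KZ.relations :=
    KZ.integrandAddRel_subset_relations ⟨b + 1, S, R₂, P, by rw [hR₂d, hSd], by rw [hSd],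
      fun z _ => by simp [P], rfl⟩
  -- 4. Newton–Leibniz: `P` folds to `B` (rule 3), primitive `d (polyLog m (u s) − polyLog m s)`
  set F : (Fin (b + 1) → ℝ) → ℝ := fun z =>
    d (Fin.init z) * (polyLog m (u (Fin.init z) * z (Fin.last b)) - polyLog m (z (Fin.last b)))
    with hF
  have hband_sub : KZlog.band G (fun _ => 1) w ⊆ {z : Fin (b + 1) → ℝ | Fin.init z ∈ G} :=
    fun z hz => hz.1
  have hdI : IsSemialgebraicFunOn ℚ (KZlog.band G (fun _ => 1) w) (fun z => d (Fin.init z)) :=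
    hd.comp_init.mono hband_sub hbw
  have huI : IsSemialgebraicFunOn ℚ (KZlog.band G (fun _ => 1) w) (fun z => u (Fin.init z)) :=
    hu.comp_init.mono hband_sub hbw
  have hsI : IsSemialgebraicFunOn ℚ (KZlog.band G (fun _ => 1) w) (fun z => z (Fin.last b)) :=
    isSemialgebraicFunOn_apply hbw (Fin.last b)
  have husI : IsSemialgebraicFunOn ℚ (KZlog.band G (fun _ => 1) w)
      (fun z => u (Fin.init z) * z (Fin.last b)) := IsSemialgebraicFunOn.mul_holds huI hsI
  have hFsa : IsSemialgebraicFunOn ℚ P.domain F := by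
    have h := IsSemialgebraicFunOn.mul_holds hdI (IsSemialgebraicFunOn.sub_holds
      (isSemialgebraicFunOn_polyLog_comp hbw husI m) (isSemialgebraicFunOn_polyLog_comp hbw hsI m))
    exact h.congr fun z _ => by simp [hF]
  have hNL : KZ.of P - KZ.of B ∈ KZ.relations := by
    refine KZ.newtonLeibnizRel_subset_relations ⟨b, P, B, fun _ => 1, w, F, hFsa, ?_, ?_, ?_, ?_,
      ?_, ?_, ?_, rfl⟩
    · rw [hBd]; exact hc1
    · rw [hBd]; exact hw
    · rw [hBd]; exact hw1
    · rw [hBd]; rfl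
    · intro x _
      have hc : Continuous fun t : ℝ => F (Fin.snoc x t) := by
        simp only [hF, Fin.init_snoc, Fin.snoc_last]
        exact continuous_const.mul (((continuous_polyLog m).comp (continuous_const.mul
          continuous_id)).sub (continuous_polyLog m))
      exact hc.continuousOn
    · intro x hx t ht
      rw [hBd] at hx
      have hux : 1 ≤ u x := hu1 x hx
      have ht0 : t ≠ 0 := (one_pos.trans ht.1).ne'
      have hut0 : u x * t ≠ 0 := mul_ne_zero (one_pos.trans_le hux).ne' ht0
      have hmem : (Fin.snoc x t : Fin (b + 1) → ℝ) ∈ KZlog.band G (fun _ => 1) w := by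
        rw [KZlog.snoc_mem_band]; exact ⟨hx, Ioo_subset_Icc_self ht⟩
      have hPz : P.integrand (Fin.snoc x t) =
          d x * (((u x * t - 1) ^ m - (-1) ^ m) / (u x * t) * u x -
            ((t - 1) ^ m - (-1) ^ m) / t) := by
        show S.integrand (Fin.snoc x t) - R₂.integrand (Fin.snoc x t) = _
        rw [hSi (hSd ▸ hmem), hR₂i (hR₂d ▸ hmem)]
        simp only [Fin.init_snoc, Fin.snoc_last]
        field_simp
        ring
      rw [hPz]
      have h1 : HasDerivAt (fun s : ℝ => polyLog m (u x * s))
          (((u x * t - 1) ^ m - (-1) ^ m) / (u x * t) * u x) t := by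
        have hlin : HasDerivAt (fun s : ℝ => u x * s) (u x) t := by
          simpa using (hasDerivAt_id t).const_mul (u x)
        exact (hasDerivAt_polyLog m hut0).comp t hlin
      have h2 := hasDerivAt_polyLog m ht0
      have h3 := (h1.sub h2).const_mul (d x)
      simp only [hF, Fin.init_snoc, Fin.snoc_last]
      exact h3
    · intro x hx
      rw [hBi hx]
      rw [hBd] at hx
      simp only [hF, Fin.init_snoc, Fin.snoc_last, mul_one, polyLog_one, rho]
      ring
  -- 5. assemble
  have e : KZ.of R - KZ.of R₁ - KZ.of R₂ - KZ.of B =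
      (KZ.of R - KZ.of Rl - KZ.of Ru) + (KZ.of Rl - KZ.of R₁) - (KZ.of S - KZ.of Ru) +
        (KZ.of S - KZ.of R₂ - KZ.of P) + (KZ.of P - KZ.of B) := by abel
  rw [e]
  exact add_mem (add_mem (sub_mem (add_mem hsplit hl) hmain) hPrel) hNL

/-! ### §3d Discharging the rescaled band: `RegTorusProductPos` PROVED unconditionally -/

/-- Tonelli on a band: the absolute fibre integrals of a representation are integrable on the base.
[folklore] -/
theorem integrableOn_fibre_abs_band (r : KZ.IntegralRep (b + 1)) {G : Set (Fin b → ℝ)}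
    {a c : (Fin b → ℝ) → ℝ} (hdom : r.domain = KZlog.band G a c) (hGm : MeasurableSet G)
    {F : (Fin b → ℝ) → ℝ → ℝ}
    (hF : ∀ x ∈ G, ∀ t ∈ Icc (a x) (c x), r.integrand (Fin.snoc x t) = F x t) :
    IntegrableOn (fun x => ∫ t in Icc (a x) (c x), |F x t|) G := by
  have hI : Integrable (r.domain.indicator r.integrand) :=
    (integrable_indicator_iff (KZ.IntegralRep.measurableSet_domain_holds r)).2 r.integrableOn
  have h1 := (integrable_snoc_prod hI).integral_norm_prod_right
  refine (h1.integrableOn (s := G)).congr_fun (fun x hx => ?_) hGm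
  have hind : (fun t : ℝ => ‖r.domain.indicator r.integrand (Fin.snoc x t)‖) =
      (Icc (a x) (c x)).indicator fun t => |F x t| := by
    funext t
    by_cases ht : t ∈ Icc (a x) (c x)
    · have hmem : (Fin.snoc x t : Fin (b + 1) → ℝ) ∈ r.domain := by
        rw [hdom, KZlog.snoc_mem_band]; exact ⟨hx, ht⟩
      rw [indicator_of_mem hmem, indicator_of_mem ht, Real.norm_eq_abs, hF x hx t ht]
    · have hmem : (Fin.snoc x t : Fin (b + 1) → ℝ) ∉ r.domain := by
        rw [hdom, KZlog.snoc_mem_band]; exact fun h => ht h.2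
      rw [indicator_of_notMem hmem, indicator_of_notMem ht, norm_zero]
  show (∫ t : ℝ, ‖r.domain.indicator r.integrand (Fin.snoc x t)‖) = ∫ t in Icc (a x) (c x), |F x t|
  rw [hind, integral_indicator measurableSet_Icc]

/-- The regularised kernel with a scale: continuous on `[1, w]`. -/
theorem continuousOn_scaled_kernel (m : ℕ) (δ υ : ℝ) (S : Set ℝ) (hS : ∀ t ∈ S, t ≠ 0) :
    ContinuousOn (fun t : ℝ => δ * ((υ * t - 1) ^ m / t)) S := by
  refine continuousOn_const.mul (ContinuousOn.div ?_ continuousOn_id hS)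
  fun_prop

/-- **Fibre estimate for the rescaled band**: substituting `t' = u t`,
`∫_{[1,w]} |d (u t − 1)^m / t| dt = ∫_{[u, uw]} |d (t'−1)^m/t'| dt' ≤ ∫_{[1, uw]} |d (t'−1)^m/t'| dt'`. -/
theorem lintegral_scaled_kernel_le (m : ℕ) (δ : ℝ) {υ ω : ℝ} (hυ : 1 ≤ υ) (hω : 1 ≤ ω) :
    ∫⁻ t in Icc 1 ω, ‖δ * ((υ * t - 1) ^ m / t)‖ₑ ≤
      ‖∫ t in Icc 1 (υ * ω), |δ * ((t - 1) ^ m / t)|‖ₑ := by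
  have hυ0 : 0 < υ := one_pos.trans_le hυ
  have hυω : 1 ≤ υ * ω := one_le_mul_of_one_le_of_one_le hυ hω
  set φ : ℝ → ℝ := fun t => |δ * ((t - 1) ^ m / t)| with hφ
  have hφ_nonneg : ∀ t, 0 ≤ φ t := fun t => abs_nonneg _
  have hφ_cont : ContinuousOn φ (Icc 1 (υ * ω)) := by
    have h := continuousOn_scaled_kernel m δ 1 (Icc 1 (υ * ω))
      (fun t ht => (one_pos.trans_le ht.1).ne')
    simpa [hφ] using h.abs
  have hφ_ii : ∀ a c, 1 ≤ a → a ≤ c → c ≤ υ * ω → IntervalIntegrable φ volume a c :=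
    fun a c ha hac hc => (hφ_cont.mono (Icc_subset_Icc ha hc)).intervalIntegrable_of_Icc hac
  -- the scaled fibre function
  set g : ℝ → ℝ := fun t => δ * ((υ * t - 1) ^ m / t) with hg
  have hg_cont : ContinuousOn g (Icc 1 ω) :=
    continuousOn_scaled_kernel m δ υ (Icc 1 ω) (fun t ht => (one_pos.trans_le ht.1).ne')
  have hg_int : IntegrableOn g (Icc 1 ω) := hg_cont.integrableOn_compact isCompact_Icc
  -- left side as an `ofReal`
  have hL : ∫⁻ t in Icc 1 ω, ‖g t‖ₑ = ENNReal.ofReal (∫ t in Icc 1 ω, ‖g t‖) :=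
    (ofReal_integral_norm_eq_lintegral_enorm hg_int).symm
  -- pointwise: `‖g t‖ = φ (υ t) * υ` for `t > 0`
  have hpt : ∀ t ∈ Icc (1 : ℝ) ω, ‖g t‖ = φ (υ * t) * υ := by
    intro t ht
    have ht0 : 0 < t := one_pos.trans_le ht.1
    have key : δ * ((υ * t - 1) ^ m / t) = δ * ((υ * t - 1) ^ m / (υ * t)) * υ := by
      field_simp
    rw [Real.norm_eq_abs]
    simp only [hg, hφ]
    rw [key, abs_mul, abs_of_pos hυ0]
  have hK_nonneg : 0 ≤ ∫ t in Icc 1 (υ * ω), φ t := setIntegral_nonneg measurableSet_Icc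
    fun t _ => hφ_nonneg t
  show ∫⁻ t in Icc 1 ω, ‖g t‖ₑ ≤ ‖∫ t in Icc 1 (υ * ω), φ t‖ₑ
  rw [hL, Real.enorm_eq_ofReal hK_nonneg]
  refine ENNReal.ofReal_le_ofReal ?_
  calc ∫ t in Icc 1 ω, ‖g t‖ = ∫ t in Icc 1 ω, φ (υ * t) * υ :=
        setIntegral_congr_fun measurableSet_Icc hpt
    _ = ∫ t in (1 : ℝ)..ω, φ (υ * t) * υ := by
        rw [intervalIntegral.integral_of_le hω, integral_Icc_eq_integral_Ioc]
    _ = ∫ t in υ * 1..υ * ω, φ t := by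
        rw [intervalIntegral.integral_mul_const, mul_comm, intervalIntegral.mul_integral_comp_mul_left]
    _ ≤ ∫ t in (1 : ℝ)..υ * ω, φ t := by
        rw [mul_one]
        have hadd := intervalIntegral.integral_add_adjacent_intervals
          (hφ_ii 1 υ le_rfl hυ (le_mul_of_one_le_right hυ0.le hω))
          (hφ_ii υ (υ * ω) hυ (le_mul_of_one_le_right hυ0.le hω) le_rfl)
        have hnn : 0 ≤ ∫ t in (1 : ℝ)..υ, φ t :=
          intervalIntegral.integral_nonneg hυ fun t _ => hφ_nonneg t
        linarith
    _ = ∫ t in Icc 1 (υ * ω), φ t := by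
        rw [intervalIntegral.integral_of_le hυω, integral_Icc_eq_integral_Ioc]

end CylLog
end RegularisedLogLayer
end Summit.KontsevichZagierPeriods.RootDecompRelativeModAbsolute.Rung30571
end
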